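import Summits.BirchSwinnertonDyer.BirchSwinnertonDyer.Theses.QuadraticBranchSignedControl
import Summits.BirchSwinnertonDyer.Rank1Residual.Additive.SignedTwistPlusInvariantPart
import HarnessLib

/-!
# Route `QuadraticBranchSignedControl` (rung K8, cell `bsd-potss`), crux `EtaTransportSigned`
# (item stmt-BirchSwinnertonDyer-19115), stub `stub_etaMC_plus`, bricks (B2⁰) and (B3) of the
# decomposition frame: PACKAGING the landed plus dictionaries as Γ-equivariant isomorphisms —
# `Sel⁺(V/ℚ_∞) ≃ Sel⁺(V/Lℚ_∞)^{1}` (ctrl's (i-e)) and `Sel⁺(V/L₁ℚ_∞)^η ≃ Sel⁺(V/L₂ℚ_∞)^η` ((D3⁺) twice)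

WHAT. Two existence statements (no definition introduced), both UNCONDITIONAL and Γ_ℚ-EQUIVARIANT,
assembled from the cell's LANDED plus-sign dictionaries (x1b's (D3) series at sign `+`: ctrl's
bricks 4 `SignedTwistPlusSelmerInfty` (D3⁺), (i-d) `SignedTwistTowerTwist`, (i-e)
`SignedTwistPlusInvariantPart`), for a curve `V/ℚ`, its twist partner `W` (`C • W^{(c)} = V`,
`C' • V^{(c)} = W`), any number field(s) `L ∋ θ` (`θ² = c`, `θ ∉ ℚ`) with the (P5) local/global
binders `hD` (decomposition group at the model `E` surjects onto `Gal(Lℚ_∞/ℚ)`), `hκ₀` (`κ` onto on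
`Gal(ℚ̄/L)`), `hcop` (`p ∤ [L:ℚ]`), and the sign character `η` of `t = √c ∈ ℚ̄`:
* (B2⁰) `exists_addEquiv_strictSignedSelmerInfty_towerEta_one` — p17's plus Selmer group of `V`
  over `ℚ_∞` at the model `E` (`strictSignedSelmerInfty V κ E 1`) ≃ the INVARIANT (`η = 1`) part of
  Kobayashi's `Sel⁺(V/Lℚ_∞)` (`towerSignedSelmerInftyEta V κ L E 1 1`), commuting with `conj_g` for
  every `g ∈ Γ_ℚ` — the injective composite `Θ_* ∘ Θ'_∞` of (i-e) with its image theorem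
  `map_map_strictSignedSelmerInfty_one_eq_invariant`;
* (B3) `exists_addEquiv_towerSignedSelmerInftyEta_of_two_fields` — for TWO such fields `L₁, L₂`
  (intended: `F = ℚ(√p*)` and `K₀ = ℚ(μ_p)`) and the SAME `η`: `Sel⁺(V/L₁ℚ_∞)^η ≃ Sel⁺(V/L₂ℚ_∞)^η`,
  Γ_ℚ-equivariant — both are `Θ_∞`-images of `Sel⁺(W/ℚ_∞)` ((D3⁺)
  `map_h1TransportInfty_strictSignedSelmerInfty_one`), and the two twisted equivariances
  `Θ_∞ ∘ conj_g = η(g)·conj_g ∘ Θ_∞` cancel (`η(g)² = 1`). This is the prime-to-`p` descent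
  `Sel⁺(V/K_∞)^η ≅ Sel⁺(V/F_∞)^η` along `K_∞/F_∞` (`[K_∞ : F_∞] = (p−1)/2`) WITHOUT a new descent
  argument.
Bricks of the DISPLAYED frame `hdec` of
`Theorems/QuadraticBranchSignedControlEtaTransportPlusOfDecomposition.lean`; with (B1)
(`…EtaTransportTowerDecomposition.lean`) and (U) (`…EtaTransportCharacter.lean`) the `ℚ`-internal
side of `hdec` is reduced to the model transfer (i-f) `Kobayashi2003.signedSelmerInfty V κ 1 ≃
strictSignedSelmerInfty V κ ℚ_[p] 1`; the `F`-internal comparison (A) (ctrl's (i-c)) remains.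

HONEST FRAMING (cell `bsd-potss`, run/shared/lean/pub/bsd-potss/; FULL-BSD rank ≤ 1 programme):
TOOL THEOREMS ONLY — no definition, no named Literature fact, no `sorry`, axioms standard;
UNCONDITIONAL. Nothing about (C1_η), Kobayashi's theorems or `BSD(W, p)` is claimed; no label or
count moves. Seat `bsd-potss-k8q-c3` (prover), g0.

References: [Kobayashi2003] Def. 2.1 (p. 5), §4 p. 8 (`X⁺(E/K_∞)^η`; `X⁺(E/K_∞)^Δ ≅ X⁺(E/ℚ_∞)`);
[GreenbergLNM1716] §3 (restriction in prime-to-`p` extensions); [Dokchitser2013ParityNotes] §4.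
-/

set_option autoImplicit false
set_option linter.dupNamespace false

noncomputable section

open scoped Classical

open Field WeierstrassCurve
open Literature.NumberTheory.EllipticCurves
open Literature.NumberTheory.GaloisRepresentations
open Summit.BirchSwinnertonDyer.Rank1Residual.Additive
open Summit.BirchSwinnertonDyer.Rank1Residual.Additive.SignedTwist
open Summit.BirchSwinnertonDyer.Rank1Residual.AdditivePotMult

namespace Summit.BirchSwinnertonDyer.BirchSwinnertonDyer.Theorems

variable (W : WeierstrassCurve ℚ) (p : ℕ) [Fact p.Prime] (κ : ZpExtension ℚ p)
  {V : WeierstrassCurve ℚ} (E : Type) [Field E] [Algebra ℚ E] (η : absoluteGaloisGroup ℚ →* ℤˣ)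

/-- An injective additive hom `f : A →+ B` mapping an additive subgroup `S` ONTO `T` gives
`S ≃+ T` with underlying map `f`. [folklore] -/
theorem exists_addEquiv_of_map_eq {A B : Type*} [AddCommGroup A] [AddCommGroup B] (f : A →+ B)
    (hf : Function.Injective f) (S : AddSubgroup A) (T : AddSubgroup B) (h : S.map f = T) :
    ∃ e : S ≃+ T, ∀ s : S, ((e s : T) : B) = f s :=
  ⟨(S.equivMapOfInjective f hf).trans (AddEquiv.addSubgroupCongr h), fun _ => rfl⟩

/-- **(B2⁰) `Sel⁺(V/ℚ_∞) ≃ Sel⁺(V/Lℚ_∞)^{1}`, Γ_ℚ-equivariantly** (existence form): p17's plus Selmer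
group of `V` over `ℚ_∞` at the model `E` is identified with the invariant part of Kobayashi's
`Sel⁺(V/Lℚ_∞)` by the injective composite `Θ_* ∘ Θ'_∞` of ctrl's (i-e)
(`map_map_strictSignedSelmerInfty_one_eq_invariant`, `h1Transport_h1TransportInfty_injective`,
`h1Transport_h1TransportInfty_conjH1`). [cite: Kobayashi2003, Def. 2.1 (p. 5), §4 p. 8 (X⁺(E/K_∞)^Δ ≅ X⁺(E/ℚ_∞))]
[cite: GreenbergLNM1716, §3] -/
theorem exists_addEquiv_strictSignedSelmerInfty_towerEta_one (L : Type) [Field L] [NumberField L]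
    [(galRange (K := ℚ) L).Normal] {θ : L} {c : ℚ} (hθ : θ ∉ Set.range (algebraMap ℚ L))
    (hc : θ ^ 2 = algebraMap ℚ L c) {C C' : VariableChange ℚ} (hCV : C • W.quadraticTwist c = V)
    (hCW : C' • V.quadraticTwist c = W)
    (hη : ∀ σ : absoluteGaloisGroup ℚ, η σ = 1 ↔ σ • rootInClosure L θ = rootInClosure L θ)
    (hD : ∀ g : absoluteGaloisGroup ℚ, ∃ τ : absoluteGaloisGroup E,
      (resGalOfEmb (closureEmb (K := ℚ) E) τ)⁻¹ * g ∈ towerTopSubgroup κ L)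
    (hκ₀ : ∀ x, ∃ g ∈ galRange (K := ℚ) L, κ g = x) (hcop : (galRange (K := ℚ) L).index.Coprime p) :
    ∃ Ψ : strictSignedSelmerInfty V κ E 1 ≃+ towerSignedSelmerInftyEta V κ L E 1 1,
      ∀ (g : absoluteGaloisGroup ℚ) (s : strictSignedSelmerInfty V κ E 1),
        ((Ψ ⟨V.conjH1 p κ.kerSubgroup g s, conjH1_mem_strictSignedSelmerInfty V κ E 1 g s.2⟩ :
            towerSignedSelmerInftyEta V κ L E 1 1) : V.subgroupH1 p (towerTopSubgroup κ L)) =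
          V.conjH1 p (towerTopSubgroup κ L) g (Ψ s) := by
  let f : V.subgroupH1 p κ.kerSubgroup →+ V.subgroupH1 p (towerTopSubgroup κ L) :=
    (h1Transport W L hθ hc p hCV (towerTopSubgroup κ L) inf_le_right).toAddMonoidHom.comp
      (h1TransportInfty V L hθ hc p κ hCW)
  have hf : ∀ s, f s = h1Transport W L hθ hc p hCV (towerTopSubgroup κ L) inf_le_right
      (h1TransportInfty V L hθ hc p κ hCW s) := fun s => rfl
  have hfinj : Function.Injective f :=
    h1Transport_h1TransportInfty_injective W L hθ hc p κ hCV hCW hcop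
  have hmap : (strictSignedSelmerInfty V κ E 1).map f = towerSignedSelmerInftyEta V κ L E 1 1 := by
    rw [← map_map_strictSignedSelmerInfty_one_eq_invariant W L hθ hc p κ hCV hCW E η hη hD hκ₀ hcop,
      AddSubgroup.map_map]
    rfl
  obtain ⟨Ψ, hΨ⟩ := exists_addEquiv_of_map_eq f hfinj _ _ hmap
  refine ⟨Ψ, fun g s => ?_⟩
  rw [hΨ, hΨ, hf, hf]
  exact h1Transport_h1TransportInfty_conjH1 W L hθ hc p κ hCV hCW η hη g s

/-- `((u : ℤˣ) : ℤ) • ((u : ℤ) • x) = x` in any additive group (`u² = 1` in `ℤˣ`). [folklore] -/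
theorem units_zsmul_units_zsmul {A : Type*} [AddCommGroup A] (u : ℤˣ) (x : A) :
    ((u : ℤˣ) : ℤ) • (((u : ℤˣ) : ℤ) • x) = x := by
  rw [smul_smul, Int.units_coe_mul_self, one_zsmul]

/-- **(B3) `Sel⁺(V/L₁ℚ_∞)^η ≃ Sel⁺(V/L₂ℚ_∞)^η`, Γ_ℚ-equivariantly, for two fields containing square
roots of the same `c`** (existence form): both are the `Θ_∞`-images of `Sel⁺(W/ℚ_∞)` for the twist
partner `W` of `V` ((D3⁺) `map_h1TransportInfty_strictSignedSelmerInfty_one` at `L₁` and at `L₂`,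
`h1TransportInfty_injective`); the equivariances `Θ_∞ ∘ conj_g = η(g)·conj_g ∘ Θ_∞`
(`h1TransportInfty_conjH1`) cancel since `η(g)² = 1`. Intended: `L₁ = F = ℚ(√p*) ⊂ L₂ = K₀ = ℚ(μ_p)`,
`c = p*`: the prime-to-`p` descent `X⁺(V/K_∞)^η ≅ X⁺(V/F_∞)^η`.
[cite: Kobayashi2003, Def. 2.1 (p. 5), §4 p. 8 (X⁺(E/K_∞)^η)] [cite: GreenbergLNM1716, §3] -/
theorem exists_addEquiv_towerSignedSelmerInftyEta_of_two_fields (L₁ : Type) [Field L₁]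
    [NumberField L₁] [(galRange (K := ℚ) L₁).Normal] (L₂ : Type) [Field L₂] [NumberField L₂]
    [(galRange (K := ℚ) L₂).Normal] {θ₁ : L₁} {θ₂ : L₂} {c : ℚ}
    (hθ₁ : θ₁ ∉ Set.range (algebraMap ℚ L₁)) (hc₁ : θ₁ ^ 2 = algebraMap ℚ L₁ c)
    (hθ₂ : θ₂ ∉ Set.range (algebraMap ℚ L₂)) (hc₂ : θ₂ ^ 2 = algebraMap ℚ L₂ c)
    {C : VariableChange ℚ} (hCV : C • W.quadraticTwist c = V)
    (hη₁ : ∀ σ : absoluteGaloisGroup ℚ, η σ = 1 ↔ σ • rootInClosure L₁ θ₁ = rootInClosure L₁ θ₁)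
    (hη₂ : ∀ σ : absoluteGaloisGroup ℚ, η σ = 1 ↔ σ • rootInClosure L₂ θ₂ = rootInClosure L₂ θ₂)
    (hD₁ : ∀ g : absoluteGaloisGroup ℚ, ∃ τ : absoluteGaloisGroup E,
      (resGalOfEmb (closureEmb (K := ℚ) E) τ)⁻¹ * g ∈ towerTopSubgroup κ L₁)
    (hD₂ : ∀ g : absoluteGaloisGroup ℚ, ∃ τ : absoluteGaloisGroup E,
      (resGalOfEmb (closureEmb (K := ℚ) E) τ)⁻¹ * g ∈ towerTopSubgroup κ L₂)
    (hκ₁ : ∀ x, ∃ g ∈ galRange (K := ℚ) L₁, κ g = x) (hκ₂ : ∀ x, ∃ g ∈ galRange (K := ℚ) L₂, κ g = x)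
    (hcop₁ : (galRange (K := ℚ) L₁).index.Coprime p) (hcop₂ : (galRange (K := ℚ) L₂).index.Coprime p) :
    ∃ Ψ : towerSignedSelmerInftyEta V κ L₁ E η 1 ≃+ towerSignedSelmerInftyEta V κ L₂ E η 1,
      ∀ (g : absoluteGaloisGroup ℚ) (t : towerSignedSelmerInftyEta V κ L₁ E η 1),
        ((Ψ ⟨V.conjH1 p (towerTopSubgroup κ L₁) g t,
              conjH1_mem_towerSignedSelmerInftyEta V κ L₁ E η 1 g t.2⟩ :
            towerSignedSelmerInftyEta V κ L₂ E η 1) : V.subgroupH1 p (towerTopSubgroup κ L₂)) =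
          V.conjH1 p (towerTopSubgroup κ L₂) g (Ψ t) := by
  -- the two dictionaries `Θᵢ : Sel⁺(W/ℚ_∞) ≃ Sel⁺(V/Lᵢℚ_∞)^η`
  obtain ⟨e₁, he₁⟩ := exists_addEquiv_of_map_eq (h1TransportInfty W L₁ hθ₁ hc₁ p κ hCV)
    (h1TransportInfty_injective W L₁ hθ₁ hc₁ p κ hCV hcop₁) _ _
    (map_h1TransportInfty_strictSignedSelmerInfty_one W L₁ hθ₁ hc₁ p κ hCV E η hη₁ hD₁ hκ₁ hcop₁)
  obtain ⟨e₂, he₂⟩ := exists_addEquiv_of_map_eq (h1TransportInfty W L₂ hθ₂ hc₂ p κ hCV)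
    (h1TransportInfty_injective W L₂ hθ₂ hc₂ p κ hCV hcop₂) _ _
    (map_h1TransportInfty_strictSignedSelmerInfty_one W L₂ hθ₂ hc₂ p κ hCV E η hη₂ hD₂ hκ₂ hcop₂)
  refine ⟨e₁.symm.trans e₂, fun g t => ?_⟩
  -- `s = Θ₁⁻¹ t`, and `Θ₁⁻¹ (conj_g t) = η(g) · conj_g s`
  set s : strictSignedSelmerInfty W κ E 1 := e₁.symm t with hs
  have hts : e₁ s = t := by rw [hs, AddEquiv.apply_symm_apply]
  let s' : strictSignedSelmerInfty W κ E 1 :=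
    ⟨((η g : ℤˣ) : ℤ) • W.conjH1 p κ.kerSubgroup g s,
      AddSubgroup.zsmul_mem _ (conjH1_mem_strictSignedSelmerInfty W κ E 1 g s.2) _⟩
  have hs' : e₁.symm ⟨V.conjH1 p (towerTopSubgroup κ L₁) g t,
      conjH1_mem_towerSignedSelmerInftyEta V κ L₁ E η 1 g t.2⟩ = s' := by
    rw [AddEquiv.symm_apply_eq]
    apply Subtype.ext
    rw [he₁]
    change V.conjH1 p (towerTopSubgroup κ L₁) g t =
      h1TransportInfty W L₁ hθ₁ hc₁ p κ hCV (((η g : ℤˣ) : ℤ) • W.conjH1 p κ.kerSubgroup g s)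
    rw [map_zsmul, h1TransportInfty_conjH1 W L₁ hθ₁ hc₁ p κ hCV η hη₁, units_zsmul_units_zsmul,
      ← he₁ s, hts]
  rw [AddEquiv.trans_apply, AddEquiv.trans_apply, hs', he₂, ← hs, he₂]
  change h1TransportInfty W L₂ hθ₂ hc₂ p κ hCV (((η g : ℤˣ) : ℤ) • W.conjH1 p κ.kerSubgroup g s) = _
  rw [map_zsmul, h1TransportInfty_conjH1 W L₂ hθ₂ hc₂ p κ hCV η hη₂, units_zsmul_units_zsmul]

end Summit.BirchSwinnertonDyer.BirchSwinnertonDyer.Theorems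

end
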